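import Literature.MathematicalPhysics.QuantumLattice.HubbardModel
import Literature.MathematicalPhysics.QuantumLattice.HubbardLiebConfig
import Literature.MathematicalPhysics.QuantumLattice.HubbardSzSectorLadder
import Literature.MathematicalPhysics.QuantumLattice.HubbardOneParticleCost
import HarnessLib

/-!
# Route `AposterioriCapRg` — crux `SsbToEvenTorusLro` (stmt-HubbardSuperconductivity-1315),
# line `number-projected-canonical-slope`, stub `stub_spinWalk` — part 1: the abstract walk

Support file for `AposterioriCapRgSsbToEvenTorusLroSpinWalk.lean` (the stub `stub_spinWalk` of the
line `number-projected-canonical-slope`): the model-independent half of the "spin walk" which moves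
a unit vector of the coordinate sector `(N↑, N↓) = (a, b)` of a Hubbard-type Fock space into the
sector `(n, n) = szSector (2n) 0`, one electron at a time, controlling the Rayleigh quotient of an
arbitrary operator `A` by the commutator norms `‖[A, c_{xσ}]‖, ‖[A, c†_{xσ}]‖ ≤ K`.

* `sw_exists_unit_trial` — ONE AVERAGED STEP, for any finite family of operators `T_k` of norm `≤ 1`
  with `Σ_k T_kᴴ T_k χ = M χ` (`M > 0`) on a unit vector `χ`: summing
  `⟨T_kχ, A T_kχ⟩ = ⟨T_kχ, T_k Aχ⟩ + ⟨T_kχ, [A, T_k]χ⟩` over `k` gives `M ⟨χ, Aχ⟩` plus an error of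
  modulus `≤ |ι| K`, while the weights `‖T_kχ‖²` sum to `M`; hence some normalised `T_kχ` has
  `Re⟨·, A ·⟩ ≤ Re⟨χ, Aχ⟩ + K|ι|/M` ("some term does at least as well as the weighted average").
* `sw_sum_numberOp_mulVec`, `sw_sum_creation_mulVec` — the weights: `N_σ χ = mχ` on the sector
  (removal, `T_x = c_{xσ}`) and `Σ_x c_{xσ}c†_{xσ} χ = (|Λ| - m)χ` (addition, `T_x = c†_{xσ}`).
* `sw_walk_down`, `sw_walk_up`, `sw_walk`, `sw_main` — iterating the step from `N_σ = m` to
  `N_σ = n` at cost `≤ D|m - n|` per species, given a per-step budget `D ≥ K|Λ|/m` (`m > n`) resp.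
  `D ≥ K|Λ|/(|Λ| - m)` (`m < n`); the sector bookkeeping is an abstract predicate `S m`
  (instantiated with `IsInSector m b`, `IsInSector n m` of `HubbardSzSectorLadder.lean`); both
  species land in `szSector (2n) 0`; `stub_spinWalkSteps` is the registered torus instance.

Part 2 supplies `K` for `A = H + κ W_R` on the torus (graded locality) and the budgets `D` at
densities `ρ₀L² ≤ n ≤ L²/2`. Everything is proved; no definition. Pattern:
`HubbardOneParticleCost.lean` (`groundEnergyAt_pred_le` / `_succ_le`).

Sources: H. Tasaki, *Physics and Mathematics of Quantum Many-Body Systems* (2020), §2.1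
(variational principle), §9.3 (sectors of the Hubbard model); E. H. Lieb, PRL 62 (1989) 1201,
eq. (2) and proof of Theorem 1 (work in a sector); D. Ruelle, *Statistical Mechanics: Rigorous
Results* (1969), §3.4 (a priori density-Lipschitz bounds, classical analogue); O. Bratteli,
D. W. Robinson, *Operator Algebras and QSM II*, §5.2.2 (CAR). [folklore]
-/

noncomputable section

namespace Summit.HubbardSuperconductivity.HubbardSuperconductivity.Theorems

-- the problem namespace `…HubbardSuperconductivity.HubbardSuperconductivity…` is doubled by design
set_option linter.dupNamespace false

open Literature.MathematicalPhysics.QuantumLattice Matrix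
open scoped Matrix ComplexOrder ComplexConjugate Matrix.Norms.L2Operator

/-! ### One averaged step -/

section Generic

variable {n ι : Type*} [Fintype n] [DecidableEq n] [Fintype ι]

/-- **One averaged step.** Let `T_k` (`k : ι`) be operators of norm `≤ 1` with
`Σ_k T_kᴴ T_k χ = M χ`, `M > 0`, for a unit vector `χ`, and `‖[A, T_k]‖ ≤ K`. Then some normalised
trial vector `c T_k χ` satisfies `Re⟨cT_kχ, A cT_kχ⟩ ≤ Re⟨χ, Aχ⟩ + K|ι|/M`: summing
`⟨T_kχ, A T_kχ⟩ = ⟨T_kχ, T_k Aχ⟩ + ⟨T_kχ, [A, T_k]χ⟩` over `k` gives `M⟨χ, Aχ⟩` plus an error of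
modulus `≤ |ι| K`, the weights `‖T_kχ‖²` sum to `M`, and some term does at least as well as the
weighted average. [folklore] -/
theorem sw_exists_unit_trial (A : Matrix n n ℂ) (T : ι → Matrix n n ℂ) (χ : n → ℂ) {M K : ℝ}
    (hM : 0 < M) (hT : (∑ k, (T k)ᴴ * T k) *ᵥ χ = (M : ℂ) • χ)
    (hK : ∀ k, ‖A * T k - T k * A‖ ≤ K) (hT1 : ∀ k, ‖T k‖ ≤ 1) (hχ1 : star χ ⬝ᵥ χ = 1) :
    ∃ k, ∃ c : ℂ, star (c • (T k *ᵥ χ)) ⬝ᵥ (c • (T k *ᵥ χ)) = 1 ∧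
      (star (c • (T k *ᵥ χ)) ⬝ᵥ (A *ᵥ (c • (T k *ᵥ χ)))).re ≤
        (star χ ⬝ᵥ (A *ᵥ χ)).re + K * Fintype.card ι / M := by
  set φ : ι → (n → ℂ) := fun k => T k *ᵥ χ with hφ
  set w : ι → ℝ := fun k => (star (φ k) ⬝ᵥ φ k).re with hw
  set f : ι → ℝ := fun k => (star (φ k) ⬝ᵥ (A *ᵥ φ k)).re with hf
  set e : ℝ := (star χ ⬝ᵥ (A *ᵥ χ)).re with he
  -- the Hermitian operator `S = Σ_k T_kᴴ T_k`
  have hS : (∑ k, (T k)ᴴ * T k)ᴴ = ∑ k, (T k)ᴴ * T k := by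
    rw [conjTranspose_sum]
    refine Finset.sum_congr rfl fun k _ => ?_
    rw [conjTranspose_mul, conjTranspose_conjTranspose]
  -- `Σ_k ⟨T_kχ, T_k y⟩ = M ⟨χ, y⟩`
  have hkey : ∀ y : n → ℂ, ∑ k, star (φ k) ⬝ᵥ (T k *ᵥ y) = (M : ℂ) * (star χ ⬝ᵥ y) := by
    intro y
    have h1 : ∀ k, star (φ k) ⬝ᵥ (T k *ᵥ y) = star χ ⬝ᵥ (((T k)ᴴ * T k) *ᵥ y) := by
      intro k
      simp only [hφ]
      rw [ThermodynamicLimit.star_mulVec_dotProduct, mulVec_mulVec]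
    simp_rw [h1]
    rw [← dotProduct_sum, ← Matrix.sum_mulVec, ← hS, ← ThermodynamicLimit.star_mulVec_dotProduct,
      hT, star_smul, smul_dotProduct, smul_eq_mul, Complex.star_def, Complex.conj_ofReal]
  -- total weight
  have hW : ∑ k, w k = M := by
    have h := congrArg Complex.re (hkey χ)
    rw [hχ1, mul_one, Complex.re_sum, Complex.ofReal_re] at h
    exact h
  -- norms
  have hnormχ : ‖(WithLp.toLp 2 χ : EuclideanSpace ℂ n)‖ = 1 := by
    rw [← pow_eq_one_iff_of_nonneg (norm_nonneg _) two_ne_zero, ThermodynamicLimit.norm_toLp_sq χ,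
      hχ1, Complex.one_re]
  have hnormφ : ∀ k, ‖(WithLp.toLp 2 (φ k) : EuclideanSpace ℂ n)‖ ≤ 1 := by
    intro k
    calc ‖(WithLp.toLp 2 (φ k) : EuclideanSpace ℂ n)‖
        ≤ ‖T k‖ * ‖(WithLp.toLp 2 χ : EuclideanSpace ℂ n)‖ :=
          ThermodynamicLimit.norm_toLp_mulVec_le _ _
      _ ≤ 1 * 1 := by
          gcongr
          · exact hT1 k
          · exact hnormχ.le
      _ = 1 := one_mul _
  -- total energy of the trial vectors
  have hF : ∑ k, f k ≤ e * M + Fintype.card ι * K := by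
    have hsplit : ∀ k, A *ᵥ φ k = T k *ᵥ (A *ᵥ χ) + (A * T k - T k * A) *ᵥ χ := by
      intro k
      simp only [hφ]
      rw [sub_mulVec, ← mulVec_mulVec, ← mulVec_mulVec]
      abel
    have hX : ∀ k, (star (φ k) ⬝ᵥ ((A * T k - T k * A) *ᵥ χ)).re ≤ K := by
      intro k
      refine (Complex.re_le_norm _).trans
        ((ThermodynamicLimit.norm_star_dotProduct_mulVec_le _ _ _).trans ?_)
      rw [hnormχ, mul_one]
      calc _ ≤ 1 * K := mul_le_mul (hnormφ k) (hK k) (norm_nonneg _) zero_le_one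
        _ = K := one_mul K
    have hfk : ∀ k, f k = (star (φ k) ⬝ᵥ (T k *ᵥ (A *ᵥ χ))).re +
        (star (φ k) ⬝ᵥ ((A * T k - T k * A) *ᵥ χ)).re := by
      intro k
      simp only [hf]
      rw [hsplit, dotProduct_add, Complex.add_re]
    simp_rw [hfk]
    rw [Finset.sum_add_distrib, ← Complex.re_sum, hkey, Complex.re_ofReal_mul]
    have h2 : ∑ k, (star (φ k) ⬝ᵥ ((A * T k - T k * A) *ᵥ χ)).re ≤ ∑ _k : ι, K :=
      Finset.sum_le_sum fun k _ => hX k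
    rw [Finset.sum_const, Finset.card_univ, nsmul_eq_mul] at h2
    have h3 : M * e = e * M := mul_comm _ _
    linarith
  -- some trial vector does at least as well as the weighted average
  obtain ⟨k, hk0, hk⟩ : ∃ k, φ k ≠ 0 ∧ f k ≤ (e + K * Fintype.card ι / M) * w k := by
    by_contra hcon
    push Not at hcon
    have hex : ∃ k, φ k ≠ 0 := by
      by_contra hall
      push Not at hall
      have h0 : ∑ k, w k = 0 := Finset.sum_eq_zero fun k _ => by simp [hw, hall k]
      linarith
    have hlt : ∑ k, (e + K * Fintype.card ι / M) * w k < ∑ k, f k := by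
      refine Finset.sum_lt_sum (fun k _ => ?_) ?_
      · by_cases hk : φ k = 0
        · simp [hf, hw, hk]
        · exact (hcon k hk).le
      · obtain ⟨k, hk⟩ := hex
        exact ⟨k, Finset.mem_univ _, hcon k hk⟩
    rw [← Finset.mul_sum, hW] at hlt
    have h4 : (e + K * Fintype.card ι / M) * M = e * M + Fintype.card ι * K := by
      field_simp
    linarith
  -- normalise it
  obtain ⟨c, -, hc1⟩ := exists_smul_unit hk0
  refine ⟨k, c, hc1, ?_⟩
  have hcc : star c * c = ((‖c‖ ^ 2 : ℝ) : ℂ) := by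
    rw [Complex.star_def, Complex.conj_mul']
    push_cast
    rfl
  have hwk : ‖c‖ ^ 2 * w k = 1 := by
    have h := congrArg Complex.re hc1
    rwa [star_smul, smul_dotProduct, dotProduct_smul, smul_smul, hcc, smul_eq_mul,
      Complex.re_ofReal_mul, Complex.one_re] at h
  change (star (c • φ k) ⬝ᵥ (A *ᵥ (c • φ k))).re ≤ e + K * Fintype.card ι / M
  rw [mulVec_smul, star_smul, smul_dotProduct, dotProduct_smul, smul_smul, hcc, smul_eq_mul,
    Complex.re_ofReal_mul]
  calc ‖c‖ ^ 2 * (star (φ k) ⬝ᵥ (A *ᵥ φ k)).re = ‖c‖ ^ 2 * f k := rfl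
    _ ≤ ‖c‖ ^ 2 * ((e + K * Fintype.card ι / M) * w k) := mul_le_mul_of_nonneg_left hk (sq_nonneg _)
    _ = (e + K * Fintype.card ι / M) * (‖c‖ ^ 2 * w k) := by ring
    _ = e + K * Fintype.card ι / M := by rw [hwk, mul_one]

end Generic

/-! ### Number operators on the sectors -/

section Sector

variable {Λ : Type*} [LinearOrder Λ] [Fintype Λ]

/-- `N_↑ χ = a χ` and `N_↓ χ = b χ` on the coordinate sector `(N↑, N↓) = (a, b)` (`N_σ = Σ_x n_{xσ}`
is diagonal in the occupation basis). Lieb, PRL 62 (1989) 1201, eq. (2). [folklore] -/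
theorem sw_sum_numberOp_mulVec {a b : ℕ} {ψ : Fock (Orb Λ)} (h : IsInSector a b ψ) (σ : Fin 2) :
    (∑ x : Λ, numberOp x σ) *ᵥ ψ = ((if σ = 0 then a else b : ℕ) : ℂ) • ψ := by
  funext s
  rw [Matrix.sum_mulVec, Finset.sum_apply, Pi.smul_apply, smul_eq_mul]
  simp only [LiebThm1.numberOp_eq_diagonal, mulVec_diagonal]
  rw [← Finset.sum_mul, Finset.sum_boole]
  by_cases hs : (upPart s).card = a ∧ (downPart s).card = b
  · congr 1
    match σ with
    | 0 => rw [if_pos rfl, ← hs.1]; rfl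
    | 1 => rw [if_neg (by decide), ← hs.2]; rfl
  · rw [h s hs, mul_zero, mul_zero]

/-- `Σ_x c_{xσ} c†_{xσ} χ = (|Λ| - m) χ` when `N_σ χ = m χ` (CAR: `c c† = 1 - n`). [folklore] -/
theorem sw_sum_creation_mulVec {m : ℕ} {ψ : Fock (Orb Λ)} (σ : Fin 2)
    (h : (∑ x : Λ, numberOp x σ) *ᵥ ψ = (m : ℂ) • ψ) :
    (∑ x : Λ, (creation (orb x σ))ᴴ * creation (orb x σ)) *ᵥ ψ =
      ((Fintype.card Λ : ℂ) - m) • ψ := by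
  have hx : ∀ x : Λ, (creation (orb x σ))ᴴ * creation (orb x σ) =
      (1 : Matrix (Finset (Orb Λ)) (Finset (Orb Λ)) ℂ) - numberOp x σ := by
    intro x
    have hcar :=
      annihilation_mul_creation_add_creation_mul_annihilation_holds (ι := Orb Λ) (orb x σ) (orb x σ)
    rw [if_pos rfl] at hcar
    rw [creation, conjTranspose_conjTranspose, ← creation, numberOp, ← hcar, add_sub_cancel_right]
  simp_rw [hx]
  rw [Finset.sum_sub_distrib, sub_mulVec, h, Matrix.sum_mulVec]
  simp_rw [one_mulVec]
  rw [Finset.sum_const, Finset.card_univ, ← Nat.cast_smul_eq_nsmul ℂ, sub_smul]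

end Sector

/-! ### The walk in one spin species -/

section Walk

variable {Λ : Type*} [LinearOrder Λ] [Fintype Λ]

/-- **Walking down**: removing `k` electrons of spin `σ` one at a time from a unit vector with
`N_σ = n + k`, at cost `≤ D` per step (the averaged step `sw_exists_unit_trial` with the trial
vectors `c_{xσ} χ`, total weight `N_σ = n + k`, and `K|Λ|/N_σ ≤ D` while `N_σ > n`). The sector
bookkeeping is abstracted into the predicate `S m` ("`N_σ = m`, other quantum numbers fixed").
[folklore] -/
theorem sw_walk_down (A : Matrix (Finset (Orb Λ)) (Finset (Orb Λ)) ℂ) (σ : Fin 2)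
    (S : ℕ → Fock (Orb Λ) → Prop)
    (hSa : ∀ (m : ℕ) (ψ : Fock (Orb Λ)) (x : Λ), S (m + 1) ψ → S m (annihilation (orb x σ) *ᵥ ψ))
    (hSs : ∀ (m : ℕ) (ψ : Fock (Orb Λ)) (c : ℂ), S m ψ → S m (c • ψ))
    (hSn : ∀ (m : ℕ) (ψ : Fock (Orb Λ)), S m ψ → (∑ x : Λ, numberOp x σ) *ᵥ ψ = (m : ℂ) • ψ)
    {K D : ℝ} {n : ℕ} (hKa : ∀ x : Λ, ‖A * annihilation (orb x σ) - annihilation (orb x σ) * A‖ ≤ K)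
    (hDa : ∀ m : ℕ, n < m → K * Fintype.card Λ / m ≤ D) :
    ∀ (k : ℕ) (χ : Fock (Orb Λ)), S (n + k) χ → star χ ⬝ᵥ χ = 1 →
      ∃ χ' : Fock (Orb Λ), S n χ' ∧ star χ' ⬝ᵥ χ' = 1 ∧
        (star χ' ⬝ᵥ (A *ᵥ χ')).re ≤ (star χ ⬝ᵥ (A *ᵥ χ)).re + D * k := by
  intro k
  induction k with
  | zero =>
    intro χ hχ hχ1
    exact ⟨χ, hχ, hχ1, by simp⟩
  | succ k ih =>
    intro χ hχ hχ1
    have hM : (0 : ℝ) < ((n + (k + 1) : ℕ) : ℝ) := by positivity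
    have hT : (∑ x : Λ, (annihilation (orb x σ))ᴴ * annihilation (orb x σ)) *ᵥ χ =
        ((((n + (k + 1) : ℕ) : ℝ)) : ℂ) • χ := by
      rw [Complex.ofReal_natCast]
      exact hSn _ _ hχ
    obtain ⟨x, c, h1, h2⟩ := sw_exists_unit_trial A (fun x : Λ => annihilation (orb x σ)) χ hM hT
      hKa (fun x => norm_annihilation_le_one (ι := Orb Λ) (orb x σ)) hχ1
    have hS1 : S (n + k) (c • (annihilation (orb x σ) *ᵥ χ)) := hSs _ _ c (hSa _ _ x hχ)
    obtain ⟨χ', hχ', hχ'1, hχ'2⟩ := ih _ hS1 h1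
    refine ⟨χ', hχ', hχ'1, hχ'2.trans ?_⟩
    have hstep := hDa (n + (k + 1)) (by omega)
    push_cast at h2 hstep ⊢
    linarith

/-- **Walking up**: adding `k` electrons of spin `σ` one at a time to a unit vector with
`N_σ = m`, `m + k = n ≤ |Λ|`, at cost `≤ D` per step (the averaged step with the trial vectors
`c†_{xσ} χ`, total weight `|Λ| - N_σ`, and `K|Λ|/(|Λ| - N_σ) ≤ D` while `N_σ < n`). [folklore] -/
theorem sw_walk_up (A : Matrix (Finset (Orb Λ)) (Finset (Orb Λ)) ℂ) (σ : Fin 2)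
    (S : ℕ → Fock (Orb Λ) → Prop)
    (hSc : ∀ (m : ℕ) (ψ : Fock (Orb Λ)) (x : Λ), S m ψ → S (m + 1) (creation (orb x σ) *ᵥ ψ))
    (hSs : ∀ (m : ℕ) (ψ : Fock (Orb Λ)) (c : ℂ), S m ψ → S m (c • ψ))
    (hSn : ∀ (m : ℕ) (ψ : Fock (Orb Λ)), S m ψ → (∑ x : Λ, numberOp x σ) *ᵥ ψ = (m : ℂ) • ψ)
    {K D : ℝ} {n : ℕ} (hKc : ∀ x : Λ, ‖A * creation (orb x σ) - creation (orb x σ) * A‖ ≤ K)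
    (hDc : ∀ m : ℕ, m < n → K * Fintype.card Λ / (Fintype.card Λ - m) ≤ D)
    (hn : n ≤ Fintype.card Λ) :
    ∀ (k m : ℕ) (χ : Fock (Orb Λ)), m + k = n → S m χ → star χ ⬝ᵥ χ = 1 →
      ∃ χ' : Fock (Orb Λ), S n χ' ∧ star χ' ⬝ᵥ χ' = 1 ∧
        (star χ' ⬝ᵥ (A *ᵥ χ')).re ≤ (star χ ⬝ᵥ (A *ᵥ χ)).re + D * k := by
  intro k
  induction k with
  | zero =>
    intro m χ hm hχ hχ1
    rw [add_zero] at hm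
    subst hm
    exact ⟨χ, hχ, hχ1, by simp⟩
  | succ k ih =>
    intro m χ hm hχ hχ1
    have hmn : m < n := by omega
    have hM : (0 : ℝ) < (Fintype.card Λ : ℝ) - m := by
      have : (m : ℝ) < Fintype.card Λ := by exact_mod_cast lt_of_lt_of_le hmn hn
      linarith
    have hT : (∑ x : Λ, (creation (orb x σ))ᴴ * creation (orb x σ)) *ᵥ χ =
        (((Fintype.card Λ : ℝ) - m : ℝ) : ℂ) • χ := by
      push_cast
      exact sw_sum_creation_mulVec σ (hSn _ _ hχ)
    obtain ⟨x, c, h1, h2⟩ := sw_exists_unit_trial A (fun x : Λ => creation (orb x σ)) χ hM hT hKc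
      (fun x => norm_creation_le_one (ι := Orb Λ) (orb x σ)) hχ1
    have hS1 : S (m + 1) (c • (creation (orb x σ) *ᵥ χ)) := hSs _ _ c (hSc _ _ x hχ)
    obtain ⟨χ', hχ', hχ'1, hχ'2⟩ := ih (m + 1) _ (by omega) hS1 h1
    refine ⟨χ', hχ', hχ'1, hχ'2.trans ?_⟩
    have hstep := hDc m hmn
    push_cast at h2 hstep ⊢
    linarith

/-- **The walk in one spin species**: from `N_σ = m` to `N_σ = n` at cost `≤ D |m - n|`.
[folklore] -/
theorem sw_walk (A : Matrix (Finset (Orb Λ)) (Finset (Orb Λ)) ℂ) (σ : Fin 2)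
    (S : ℕ → Fock (Orb Λ) → Prop)
    (hSa : ∀ (m : ℕ) (ψ : Fock (Orb Λ)) (x : Λ), S (m + 1) ψ → S m (annihilation (orb x σ) *ᵥ ψ))
    (hSc : ∀ (m : ℕ) (ψ : Fock (Orb Λ)) (x : Λ), S m ψ → S (m + 1) (creation (orb x σ) *ᵥ ψ))
    (hSs : ∀ (m : ℕ) (ψ : Fock (Orb Λ)) (c : ℂ), S m ψ → S m (c • ψ))
    (hSn : ∀ (m : ℕ) (ψ : Fock (Orb Λ)), S m ψ → (∑ x : Λ, numberOp x σ) *ᵥ ψ = (m : ℂ) • ψ)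
    {K D : ℝ} {n : ℕ} (hKa : ∀ x : Λ, ‖A * annihilation (orb x σ) - annihilation (orb x σ) * A‖ ≤ K)
    (hKc : ∀ x : Λ, ‖A * creation (orb x σ) - creation (orb x σ) * A‖ ≤ K)
    (hDa : ∀ m : ℕ, n < m → K * Fintype.card Λ / m ≤ D)
    (hDc : ∀ m : ℕ, m < n → K * Fintype.card Λ / (Fintype.card Λ - m) ≤ D) (hn : n ≤ Fintype.card Λ)
    (m : ℕ) (χ : Fock (Orb Λ)) (hχ : S m χ) (hχ1 : star χ ⬝ᵥ χ = 1) :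
    ∃ χ' : Fock (Orb Λ), S n χ' ∧ star χ' ⬝ᵥ χ' = 1 ∧
      (star χ' ⬝ᵥ (A *ᵥ χ')).re ≤ (star χ ⬝ᵥ (A *ᵥ χ)).re + D * |(m : ℝ) - n| := by
  rcases le_or_gt n m with hnm | hmn
  · have hk : n + (m - n) = m := by omega
    obtain ⟨χ', h1, h2, h3⟩ := sw_walk_down A σ S hSa hSs hSn hKa hDa (m - n) χ
      (by rw [hk]; exact hχ) hχ1
    refine ⟨χ', h1, h2, h3.trans_eq ?_⟩
    rw [Nat.cast_sub hnm, abs_of_nonneg (by rw [sub_nonneg]; exact_mod_cast hnm)]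
  · obtain ⟨χ', h1, h2, h3⟩ := sw_walk_up A σ S hSc hSs hSn hKc hDc hn (n - m) m χ (by omega) hχ hχ1
    refine ⟨χ', h1, h2, h3.trans_eq ?_⟩
    rw [Nat.cast_sub hmn.le, abs_of_neg (by rw [sub_neg]; exact_mod_cast hmn), neg_sub]

end Walk

/-! ### Both species -/

section Main

variable {Λ : Type*} [LinearOrder Λ] [Fintype Λ]

/-- **The two-species walk, abstract form.** For an operator `A` on Fock space whose commutators
with all `c_{xσ}`, `c†_{xσ}` have norm `≤ K`, a target `n ≤ |Λ|`, and a per-step budget `D`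
dominating `K|Λ|/m` for `m > n` (removals) and `K|Λ|/(|Λ| - m)` for `m < n` (additions): every unit
vector of the sector `(N↑, N↓) = (a, b)` is walked into a unit vector of `szSector (2n) 0 = (n, n)`
with `Re⟨χ', Aχ'⟩ ≤ Re⟨χ, Aχ⟩ + D(|a - n| + |b - n|)` (first the up-spins, then the down-spins;
`sw_walk` twice, `mem_szSector_iff_isInSector`). [folklore] -/
theorem sw_main (A : Matrix (Finset (Orb Λ)) (Finset (Orb Λ)) ℂ) {K D : ℝ} {n : ℕ}
    (hKa : ∀ (σ : Fin 2) (x : Λ), ‖A * annihilation (orb x σ) - annihilation (orb x σ) * A‖ ≤ K)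
    (hKc : ∀ (σ : Fin 2) (x : Λ), ‖A * creation (orb x σ) - creation (orb x σ) * A‖ ≤ K)
    (hDa : ∀ m : ℕ, n < m → K * Fintype.card Λ / m ≤ D)
    (hDc : ∀ m : ℕ, m < n → K * Fintype.card Λ / (Fintype.card Λ - m) ≤ D) (hn : n ≤ Fintype.card Λ)
    {a b : ℕ} {χ : Fock (Orb Λ)} (hχ : IsInSector a b χ) (hχ1 : star χ ⬝ᵥ χ = 1) :
    ∃ χ' : Fock (Orb Λ), χ' ∈ szSector (2 * n) 0 ∧ star χ' ⬝ᵥ χ' = 1 ∧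
      (star χ' ⬝ᵥ (A *ᵥ χ')).re ≤
        (star χ ⬝ᵥ (A *ᵥ χ)).re + D * (|(a : ℝ) - n| + |(b : ℝ) - n|) := by
  -- walk the up-spins from `a` to `n` inside the sectors `(m, b)`
  obtain ⟨χ₁, hχ₁, hχ₁1, hχ₁2⟩ := sw_walk A 0 (fun m ψ => IsInSector m b ψ)
    (fun m ψ x h => h.annihilation_up_mulVec x) (fun m ψ x h => h.creation_up_mulVec x)
    (fun m ψ c h => h.smul c)
    (fun m ψ h => by have h' := sw_sum_numberOp_mulVec h 0; rwa [if_pos rfl] at h')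
    (hKa 0) (hKc 0) hDa hDc hn a χ hχ hχ1
  -- walk the down-spins from `b` to `n` inside the sectors `(n, m)`
  obtain ⟨χ', hχ', hχ'1, hχ'2⟩ := sw_walk A 1 (fun m ψ => IsInSector n m ψ)
    (fun m ψ x h => h.annihilation_down_mulVec x) (fun m ψ x h => h.creation_down_mulVec x)
    (fun m ψ c h => h.smul c)
    (fun m ψ h => by have h' := sw_sum_numberOp_mulVec h 1; rwa [if_neg (by decide)] at h')
    (hKa 1) (hKc 1) hDa hDc hn b χ₁ hχ₁ hχ₁1
  refine ⟨χ', ?_, hχ'1, ?_⟩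
  · rw [szSector_two_mul_zero_eq, mem_szSector_iff_isInSector]
    exact hχ'
  · have hsum : D * |(a : ℝ) - n| + D * |(b : ℝ) - n| = D * (|(a : ℝ) - n| + |(b : ℝ) - n|) := by
      ring
    linarith

end Main

/-! ### The registered sub-goal: the abstract walk on the torus -/

/-- **(WALK, abstract form) stub_spinWalkSteps** — `sw_main` on the fermionic torus `(ℤ/Lℤ)²`,
the registered sub-goal of `stub_spinWalk` served by this file: for an operator `A` whose
commutators with all `c_{xσ}`, `c†_{xσ}` have norm `≤ K`, a target `n ≤ |Λ|` and a per-step budget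
`D ≥ K|Λ|/m` (`m > n`), `D ≥ K|Λ|/(|Λ| - m)` (`m < n`), every unit vector of the sector `(a, b)` is
walked into a unit vector of `szSector (2n) 0` with
`Re⟨χ', Aχ'⟩ ≤ Re⟨χ, Aχ⟩ + D(|a - n| + |b - n|)`. Stated for an arbitrary
`DecidableEq (FermionTorus 2 L)` instance (on which the operator norm depends syntactically); the
proof substitutes the generic one. [folklore] -/
theorem stub_spinWalkSteps :
    ∀ (L : ℕ) [DecidableEq (FermionTorus 2 L)]
      (A : Matrix (Finset (Orb (FermionTorus 2 L))) (Finset (Orb (FermionTorus 2 L))) ℂ) (K D : ℝ)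
      (n : ℕ), (∀ (σ : Fin 2) (x : FermionTorus 2 L),
        ‖A * annihilation (orb x σ) - annihilation (orb x σ) * A‖ ≤ K) →
      (∀ (σ : Fin 2) (x : FermionTorus 2 L),
        ‖A * creation (orb x σ) - creation (orb x σ) * A‖ ≤ K) →
      (∀ m : ℕ, n < m → K * (Fintype.card (FermionTorus 2 L) : ℝ) / m ≤ D) →
      (∀ m : ℕ, m < n → K * (Fintype.card (FermionTorus 2 L) : ℝ) /
        ((Fintype.card (FermionTorus 2 L) : ℝ) - m) ≤ D) →
      n ≤ Fintype.card (FermionTorus 2 L) →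
      ∀ (a b : ℕ) (χ : Fock (Orb (FermionTorus 2 L))), IsInSector a b χ → star χ ⬝ᵥ χ = 1 →
        ∃ χ' : Fock (Orb (FermionTorus 2 L)), χ' ∈ szSector (2 * n) 0 ∧ star χ' ⬝ᵥ χ' = 1 ∧
          (star χ' ⬝ᵥ A *ᵥ χ').re ≤
            (star χ ⬝ᵥ A *ᵥ χ).re + D * (|(a : ℝ) - n| + |(b : ℝ) - n|) := by
  intro L inst A K D n hKa hKc hDa hDc hn a b χ hχ hχ1
  have hinst : inst = LinearOrder.toDecidableEq := Subsingleton.elim _ _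
  subst hinst
  exact sw_main A hKa hKc hDa hDc hn hχ hχ1

end Summit.HubbardSuperconductivity.HubbardSuperconductivity.Theorems

end
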